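import Literature.NumberTheory.NumberFields.CMFieldCapitulationKernel
import Literature.NumberTheory.NumberFields.CMFieldRelativeClassNumberDivisibility
import HarnessLib

/-!
# `2`-ranks of the class groups of a CM field and of its maximal real subfield
# (Washington Prop. 10.12; Horie, *Acta Arith.* 67 (1994), Thm. 1 (1-i); Okazaki, *Acta Arith.* 92 (2000), §5)

Topic `NumberTheory/NumberFields`; namespace `Literature.NumberTheory.NumberFields`.  Theorem-only file
(no definition, no named fact, no `sorry`).  For a CM field `K` write `Cl_K`, `Cl_{K⁺}` for the class
groups, `A_K = ker(N : Cl_K → Cl_{K⁺})` (`#A_K = h⁻_K = h_K/h_{K⁺}`, the norm being onto),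
`κ_K = #ker(ι : Cl_{K⁺} → Cl_K) ∈ {1, 2}` (Washington Thm. 10.3), and `G[2] = {g ∈ G : g² = 1}`, so that
`#G[2] = 2^{rank₂ G}`.

> Horie (1994), §1, proof of Thm. 1: "We note first of all that the inequality `r(A⁻_K) + 1 ≥ r(A_{K⁺})`
> holds in general (cf. Proposition 10.12 of [12])."  ([12] = Washington, *Introduction to Cyclotomic
> Fields*; Horie's notation, p. 219: "`A_F` the Sylow `2`-subgroup of `C_F` … `A⁻_K` the Sylow `2`-subgroup
> of the kernel of the norm map `C_K → C_{K⁺}` … As is well known, the norm map `C_K → C_{K⁺}` is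
> surjective so that `h⁻_K` equals the order of the kernel of this norm map … The rank of each finite
> abelian group `G` will be denoted by `r(G)`.")
> Horie, Thm. 1: "Let `K` be a CM-field. Let `M` denote the Hilbert `2`-class field over `K⁺`.  Then `h⁻_K`
> is odd if and only if … (1-i) `M` is cyclic over `K⁺`, i.e., `A_{K⁺}` is cyclic, (1-ii) …, (1-iii) …"
> (proof: "assume that `h⁻_K` is odd, so that (1-i) certainly holds by the above inequality").
> Okazaki (2000), §5, Remark after Lemma 26: "[27, Proposition 10.12] … is recovered as follows … the
> lemma implies `2^{r₀}/κ_F ∣ h⁻_F`" (`r₀` the `2`-rank of `C_{F⁺}`); Remark (p. 331): "Let `F` be a CM-field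
> of odd relative class number.  It is known that the `2`-rank of `C_F` is at most `1` (cf. [13, Theorem 1])
> … the `2`-rank of `C_{F⁺}` is at most `1`.  Since the `2`-parts of `C_{F⁺}` and `C_F` are isomorphic
> when `h⁻_F` is odd, we conclude that the `2`-rank of `C_F` is at most `1`."

Proofs (Washington Thm. 10.3 route): `ι` maps `Cl_{K⁺}[2]` into `A_K[2]` (`N ∘ ι = 2`), with kernel
inside `ker ι` of order `κ_K ∣ 2`; hence `#Cl_{K⁺}[2] ∣ κ_K · #A_K[2] ∣ 2 · #A_K[2]` (the rank inequality)
and `#Cl_{K⁺}[2] ∣ κ_K · h⁻_K` (Okazaki's form).  If `h⁻_K = #A_K` is odd then `A_K[2] = 1`, so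
`#Cl_{K⁺}[2] ∣ 2`; and `N` restricts to a bijection `Cl_K[2ⁿ] → Cl_{K⁺}[2ⁿ]` for every `n` (injective as
`A_K ∩ Cl_K[2ⁿ] = 1`; onto: lift `d` to `c`, then `c^{m t}` with `m = #A_K`, `m t ≡ 1 (mod 2ⁿ)` is
`2ⁿ`-torsion above `d`), so `#Cl_K[2ⁿ] = #Cl_{K⁺}[2ⁿ]` («the `2`-parts are isomorphic») and `#Cl_K[2] ∣ 2`.

## Main results (`K : Type` a CM number field)

* **`IsCMField.card_twoTorsion_classGroup_maximalRealSubfield_dvd`** — Washington Prop. 10.12, sharp form: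
  `#Cl_{K⁺}[2] ∣ κ_K · #A_K[2]`; `IsCMField.card_twoTorsion_classGroup_maximalRealSubfield_dvd_two_mul` —
  **`#Cl_{K⁺}[2] ∣ 2 · #A_K[2]`**, i.e. `rank₂ Cl_{K⁺} ≤ 1 + rank₂ A_K` (Horie's «`r(A⁻_K) + 1 ≥ r(A_{K⁺})`»);
  `IsCMField.card_twoTorsion_classGroup_maximalRealSubfield_dvd_mul_classNumber_div` — Okazaki's form
  `#Cl_{K⁺}[2] ∣ κ_K · h⁻_K`.
* **`IsCMField.card_twoTorsion_classGroup_maximalRealSubfield_dvd_two_of_odd`** — Horie Thm. 1 (1-i):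
  `h⁻_K` odd ⟹ `#Cl_{K⁺}[2] ∣ 2` (the `2`-class group of `K⁺` is cyclic).
* **`IsCMField.card_twoPowTorsion_classGroup_eq_of_odd`** — `h⁻_K` odd ⟹ `#Cl_K[2ⁿ] = #Cl_{K⁺}[2ⁿ]` for all `n`.
* **`IsCMField.card_twoTorsion_classGroup_dvd_two_of_odd`** — `h⁻_K` odd ⟹ `#Cl_K[2] ∣ 2` (Okazaki's Remark:
  the `2`-rank of `C_F` is at most `1`).
* (§3, appended) **`IsCMField.classGroupExtend_injective_of_odd_classNumber`** — `h_{K⁺}` odd ⟹ `ι : Cl_{K⁺} → Cl_K`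
  is injective; **`IsCMField.card_ambiguous_eq_classNumber_mul_card_twoTorsion_of_odd`** — for `h_{K⁺}` odd the
  ambiguous (conjugation-fixed) classes of `K` are `ι(Cl_{K⁺}) × Cl_K[2]`: **`#{c : c̄ = c} = h_{K⁺} · #Cl_K[2]`**
  (the structural half of Okazaki's proof of Lemma 17: «the group `A_F` is isomorphic to the direct product of
  `ιC_{F⁺}` and `ker(2 : C_F → C_F)` … `ιC_{F⁺}` is isomorphic to `C_{F⁺}` since `h_{F⁺}` is odd and `κ_F` divides `2`»;
  the other half, Takagi–Chevalley's count `#A_F = 2^{t-1} h_{F⁺}` under «strict `2`-rank of `C_{F⁺}` zero», is not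
  typed here).
* (§4, appended) **`IsCMField.exists_mulEquiv_primaryComponent_two_of_odd`** — «the `2`-parts of `C_{F⁺}` and `C_F`
  are isomorphic when `h⁻_F` is odd» as an isomorphism: for `h⁻_K` odd the norm restricts to a group isomorphism
  of the `2`-primary components (Sylow `2`-subgroups) `Cl_K{2} ≃* Cl_{K⁺}{2}` (Mathlib `CommGroup.primaryComponent`);
  `IsCMField.card_primaryComponent_two_classGroup_eq_of_odd` — `#Cl_K{2} = #Cl_{K⁺}{2}`.

Honest column: ranks are expressed through `#G[2]`, and «the `2`-parts are isomorphic» both through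
`#Cl_K[2ⁿ] = #Cl_{K⁺}[2ⁿ]` for every `n` (§2) and as an isomorphism of `2`-primary components (§4); Horie's conditions (1-ii),
(1-iii) and the converse direction of his Thm. 1 are not formalised; Washington's own statement and proof of
Prop. 10.12 were not consulted (cited through Horie and Okazaki).

## References

* K. Horie, *On CM-fields with the same maximal real subfield*, Acta Arith. 67 (1994) 219–227, §1, Lemma 1,
  Thm. 1 and its proof (held `paper:doi-10-4064-aa-67-3-219-227`, pp. 1–3). [Horie1994]
* R. Okazaki, *Inclusion of CM-fields and divisibility of relative class numbers*, Acta Arith. 92 (2000)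
  319–338, §5 Lemma 26 and the two Remarks after it, §3 Lemma 17 and its proof (held
  `paper:doi-10-4064-aa-92-4-319-338`, pp. 9, 12–13). [Okazaki2000]
* L. C. Washington, *Introduction to Cyclotomic Fields*, 2nd ed. (1997), Thm. 10.3, Prop. 10.12.
  [Washington1997]
-/

noncomputable section

open NumberField NumberField.IsCMField IsDedekindDomain
open scoped nonZeroDivisors

namespace Literature.NumberTheory.NumberFields

/-! ### §0. Finite abelian groups: `#G[2]` is a power of `2` -/

section Group

variable {G : Type*} [CommGroup G] [Finite G]

/-- `#{g : g² = 1}` is a power of `2` (an elementary abelian `2`-group). [folklore] -/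
private theorem exists_card_twoTorsion_eq_two_pow : ∃ k : ℕ, Nat.card {g : G // g ^ 2 = 1} = 2 ^ k := by
  haveI : Fact (Nat.Prime 2) := ⟨Nat.prime_two⟩
  have hP : IsPGroup 2 (powMonoidHom 2 : G →* G).ker := by
    intro g
    refine ⟨1, Subtype.ext ?_⟩
    have hg := g.2
    rw [MonoidHom.mem_ker, powMonoidHom_apply] at hg
    rw [pow_one, Subgroup.coe_pow, Subgroup.coe_one, hg]
  obtain ⟨k, hk⟩ := IsPGroup.iff_card.mp hP
  refine ⟨k, ?_⟩
  rw [← hk]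
  exact Nat.card_congr (Equiv.subtypeEquivRight fun g => by rw [MonoidHom.mem_ker, powMonoidHom_apply])

end Group

/-! ### §1. `#Cl_{K⁺}[2] ∣ κ_K · #A_K[2]` (Washington Prop. 10.12) and `#Cl_{K⁺}[2] ∣ κ_K · h⁻_K` (Okazaki) -/

section TwoRank

variable (K : Type) [Field K] [NumberField K] [IsCMField K]

/-- `κ_K ∣ 2` (Washington Thm. 10.3: the capitulation kernel of a CM field has order `1` or `2`).
[cite: Washington1997, Thm. 10.3] -/
theorem card_ker_classGroupExtend_dvd_two :
    Nat.card (classGroupExtend (maximalRealSubfield K) K).ker ∣ 2 := by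
  rcases card_ker_classGroupExtend_eq_one_or_two K with h | h
  · rw [h]; exact one_dvd 2
  · rw [h]

/-- **Washington's Prop. 10.12, sharp form: `#Cl_{K⁺}[2] ∣ κ_K · #A_K[2]`** for a CM field `K`
(`A_K = ker N_{K/K⁺}`, `κ_K = #ker(Cl_{K⁺} → Cl_K)`): `ι` maps `Cl_{K⁺}[2]` into `A_K[2]` (as
`N(ι c) = c² = 1`) with kernel inside `ker ι`. [cite: Horie1994, §1, proof of Thm. 1 («r(A⁻_K) + 1 ≥ r(A_{K⁺})»)]
[cite: Washington1997, Prop. 10.12 and Thm. 10.3] -/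
theorem IsCMField.card_twoTorsion_classGroup_maximalRealSubfield_dvd :
    Nat.card {c : ClassGroup (𝓞 (maximalRealSubfield K)) // c ^ 2 = 1} ∣
      Nat.card (classGroupExtend (maximalRealSubfield K) K).ker *
        Nat.card {c : (classGroupNorm (maximalRealSubfield K) K).ker // (c : ClassGroup (𝓞 K)) ^ 2 = 1} := by
  classical
  set ι := classGroupExtend (maximalRealSubfield K) K with hι
  set AK := (classGroupNorm (maximalRealSubfield K) K).ker with hAK
  set T : Subgroup (ClassGroup (𝓞 (maximalRealSubfield K))) := (powMonoidHom 2).ker with hT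
  -- the subgroup `A_K[2]` of `Cl_K`
  set A2 : Subgroup (ClassGroup (𝓞 K)) := AK ⊓ (powMonoidHom 2).ker with hA2
  have hA2card : Nat.card A2 = Nat.card {c : AK // (c : ClassGroup (𝓞 K)) ^ 2 = 1} :=
    Nat.card_congr
      { toFun := fun c => ⟨⟨c.1, (Subgroup.mem_inf.mp c.2).1⟩, by
          have h := (Subgroup.mem_inf.mp c.2).2
          rwa [MonoidHom.mem_ker, powMonoidHom_apply] at h⟩
        invFun := fun c => ⟨c.1.1, Subgroup.mem_inf.mpr ⟨c.1.2, by
          rw [MonoidHom.mem_ker, powMonoidHom_apply]; exact c.2⟩⟩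
        left_inv := fun c => Subtype.ext rfl
        right_inv := fun c => Subtype.ext (Subtype.ext rfl) }
  have hTcard : Nat.card T = Nat.card {c : ClassGroup (𝓞 (maximalRealSubfield K)) // c ^ 2 = 1} :=
    Nat.card_congr (Equiv.subtypeEquivRight fun c => by rw [hT, MonoidHom.mem_ker, powMonoidHom_apply])
  -- `ι` restricted to `Cl_{K⁺}[2]`
  set f : T →* ClassGroup (𝓞 K) := ι.comp T.subtype with hf
  have hrange : f.range ≤ A2 := by
    rintro _ ⟨c, rfl⟩
    have hc : (c : ClassGroup (𝓞 (maximalRealSubfield K))) ^ 2 = 1 := MonoidHom.mem_ker.mp c.2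
    refine Subgroup.mem_inf.mpr ⟨?_, ?_⟩
    · rw [hAK, MonoidHom.mem_ker, hf, MonoidHom.comp_apply, Subgroup.subtype_apply, hι,
        classGroupNorm_classGroupExtend (maximalRealSubfield K) K,
        (IsCMField.isQuadraticExtension K).finrank_eq_two, hc]
    · rw [MonoidHom.mem_ker, powMonoidHom_apply, hf, MonoidHom.comp_apply, Subgroup.subtype_apply,
        ← map_pow, hc, map_one]
  have hker : Nat.card f.ker ∣ Nat.card ι.ker := by
    rw [← Subgroup.card_map_of_injective (K := f.ker) T.subtype_injective]
    apply Subgroup.card_dvd_of_le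
    intro x hx
    obtain ⟨c, hc, rfl⟩ := Subgroup.mem_map.mp hx
    rw [MonoidHom.mem_ker, hf, MonoidHom.comp_apply] at hc
    exact hc
  have hcard : Nat.card f.ker * Nat.card f.range = Nat.card T := by
    rw [← Subgroup.index_ker, Subgroup.card_mul_index]
  rw [← hTcard, ← hcard, ← hA2card]
  exact Nat.mul_dvd_mul hker (Subgroup.card_dvd_of_le hrange)

/-- **`rank₂ Cl_{K⁺} ≤ 1 + rank₂ A_K`, i.e. `#Cl_{K⁺}[2] ∣ 2 · #A_K[2]`** (Horie: «`r(A⁻_K) + 1 ≥ r(A_{K⁺})`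
holds in general», `A⁻_K` the Sylow `2`-subgroup of `ker(N : C_K → C_{K⁺})`), since `κ_K ∣ 2`.
[cite: Horie1994, §1, proof of Thm. 1] [cite: Washington1997, Prop. 10.12] -/
theorem IsCMField.card_twoTorsion_classGroup_maximalRealSubfield_dvd_two_mul :
    Nat.card {c : ClassGroup (𝓞 (maximalRealSubfield K)) // c ^ 2 = 1} ∣
      2 * Nat.card {c : (classGroupNorm (maximalRealSubfield K) K).ker // (c : ClassGroup (𝓞 K)) ^ 2 = 1} := by
  exact (IsCMField.card_twoTorsion_classGroup_maximalRealSubfield_dvd K).trans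
    (Nat.mul_dvd_mul_right (card_ker_classGroupExtend_dvd_two K) _)

/-- The rank inequality as an inequality of cardinalities: `#Cl_{K⁺}[2] ≤ 2 · #A_K[2]`.
[cite: Horie1994, §1, proof of Thm. 1] [cite: Washington1997, Prop. 10.12] -/
theorem IsCMField.card_twoTorsion_classGroup_maximalRealSubfield_le_two_mul :
    Nat.card {c : ClassGroup (𝓞 (maximalRealSubfield K)) // c ^ 2 = 1} ≤
      2 * Nat.card {c : (classGroupNorm (maximalRealSubfield K) K).ker // (c : ClassGroup (𝓞 K)) ^ 2 = 1} := by
  haveI : Nonempty {c : (classGroupNorm (maximalRealSubfield K) K).ker // (c : ClassGroup (𝓞 K)) ^ 2 = 1} :=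
    ⟨⟨1, by rw [OneMemClass.coe_one, one_pow]⟩⟩
  exact Nat.le_of_dvd (Nat.mul_pos two_pos Nat.card_pos)
    (IsCMField.card_twoTorsion_classGroup_maximalRealSubfield_dvd_two_mul K)

/-- **Okazaki's form: `2^{r₀}/κ_F ∣ h⁻_F`, i.e. `#Cl_{K⁺}[2] ∣ κ_K · h⁻_K`** (`r₀` the `2`-rank of `C_{K⁺}`,
`h⁻_K = #A_K`). [cite: Okazaki2000, §5 Remark after Lemma 26] [cite: Washington1997, Prop. 10.12] -/
theorem IsCMField.card_twoTorsion_classGroup_maximalRealSubfield_dvd_mul_card_ker :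
    Nat.card {c : ClassGroup (𝓞 (maximalRealSubfield K)) // c ^ 2 = 1} ∣
      Nat.card (classGroupExtend (maximalRealSubfield K) K).ker *
        Nat.card (classGroupNorm (maximalRealSubfield K) K).ker := by
  classical
  refine (IsCMField.card_twoTorsion_classGroup_maximalRealSubfield_dvd K).trans (Nat.mul_dvd_mul_left _ ?_)
  set AK := (classGroupNorm (maximalRealSubfield K) K).ker
  have h := Subgroup.card_subgroup_dvd_card (((powMonoidHom 2).comp AK.subtype).ker)
  have e : Nat.card ((powMonoidHom 2).comp AK.subtype).ker = Nat.card {c : AK // (c : ClassGroup (𝓞 K)) ^ 2 = 1} :=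
    Nat.card_congr (Equiv.subtypeEquivRight fun c => by
      rw [MonoidHom.mem_ker, MonoidHom.comp_apply, powMonoidHom_apply, Subgroup.subtype_apply,
        ← Subgroup.coe_pow, ← Subgroup.coe_one, Subtype.coe_inj, ← Subtype.coe_inj, Subgroup.coe_pow,
        Subgroup.coe_one])
  rwa [e] at h

/-- **`#Cl_{K⁺}[2] ∣ κ_K · (h_K / h_{K⁺})`** — Okazaki's `2^{r₀}/κ_F ∣ h⁻_F` in class numbers.
[cite: Okazaki2000, §5 Remark after Lemma 26] -/
theorem IsCMField.card_twoTorsion_classGroup_maximalRealSubfield_dvd_mul_classNumber_div :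
    Nat.card {c : ClassGroup (𝓞 (maximalRealSubfield K)) // c ^ 2 = 1} ∣
      Nat.card (classGroupExtend (maximalRealSubfield K) K).ker *
        (classNumber K / classNumber (maximalRealSubfield K)) := by
  rw [IsCMField.classNumber_div_eq_card_ker]
  exact IsCMField.card_twoTorsion_classGroup_maximalRealSubfield_dvd_mul_card_ker K

/-- `#Cl_{K⁺}[2] ∣ 2 · h⁻_K`. [cite: Okazaki2000, §5 Remark after Lemma 26] [cite: Washington1997, Thm. 10.3] -/
theorem IsCMField.card_twoTorsion_classGroup_maximalRealSubfield_dvd_two_mul_classNumber_div :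
    Nat.card {c : ClassGroup (𝓞 (maximalRealSubfield K)) // c ^ 2 = 1} ∣
      2 * (classNumber K / classNumber (maximalRealSubfield K)) := by
  exact (IsCMField.card_twoTorsion_classGroup_maximalRealSubfield_dvd_mul_classNumber_div K).trans
    (Nat.mul_dvd_mul_right (card_ker_classGroupExtend_dvd_two K) _)

end TwoRank

/-! ### §2. Odd relative class number: `#Cl_{K⁺}[2] ∣ 2`, `#Cl_K[2ⁿ] = #Cl_{K⁺}[2ⁿ]`, `#Cl_K[2] ∣ 2` -/

section Odd

variable (K : Type) [Field K] [NumberField K] [IsCMField K]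

/-- If `h⁻_K` is odd then `A_K[2] = 1`. [cite: Horie1994, §1, proof of Thm. 1] -/
theorem IsCMField.card_twoTorsion_ker_eq_one_of_odd
    (hodd : Odd (classNumber K / classNumber (maximalRealSubfield K))) :
    Nat.card {c : (classGroupNorm (maximalRealSubfield K) K).ker // (c : ClassGroup (𝓞 K)) ^ 2 = 1} = 1 := by
  classical
  set AK := (classGroupNorm (maximalRealSubfield K) K).ker with hAK
  rw [IsCMField.classNumber_div_eq_card_ker] at hodd
  obtain ⟨k, hk⟩ := exists_card_twoTorsion_eq_two_pow (G := AK)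
  have e : Nat.card {c : AK // (c : ClassGroup (𝓞 K)) ^ 2 = 1} = Nat.card {c : AK // c ^ 2 = 1} :=
    Nat.card_congr (Equiv.subtypeEquivRight fun c => by
      rw [← Subtype.coe_inj, Subgroup.coe_pow, Subgroup.coe_one])
  rw [e, hk]
  have hdvd : 2 ^ k ∣ Nat.card AK := by
    rw [← hk, ← Nat.card_congr (Equiv.subtypeEquivRight (fun c : AK => by
      rw [MonoidHom.mem_ker, powMonoidHom_apply]) : ((powMonoidHom 2 : AK →* AK).ker) ≃ {c : AK // c ^ 2 = 1})]
    exact Subgroup.card_subgroup_dvd_card _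
  have hcop : Nat.Coprime (2 ^ k) (Nat.card AK) :=
    Nat.Coprime.pow_left k hodd.coprime_two_left
  exact Nat.Coprime.eq_one_of_dvd hcop hdvd

/-- **Horie's Thm. 1 (1-i): if `h⁻_K` is odd then the `2`-class group of `K⁺` is cyclic — `#Cl_{K⁺}[2] ∣ 2`**
(«assume that `h⁻_K` is odd, so that (1-i) certainly holds by the above inequality»; Okazaki: «the
`2`-rank of `C_{F⁺}` is at most `1`»). [cite: Horie1994, Thm. 1 (1-i) and its proof]
[cite: Okazaki2000, §5 Remark (p. 331)] -/
theorem IsCMField.card_twoTorsion_classGroup_maximalRealSubfield_dvd_two_of_odd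
    (hodd : Odd (classNumber K / classNumber (maximalRealSubfield K))) :
    Nat.card {c : ClassGroup (𝓞 (maximalRealSubfield K)) // c ^ 2 = 1} ∣ 2 := by
  have h := IsCMField.card_twoTorsion_classGroup_maximalRealSubfield_dvd_two_mul K
  rwa [IsCMField.card_twoTorsion_ker_eq_one_of_odd K hodd, mul_one] at h

/-- **If `h⁻_K` is odd then `#Cl_K[2ⁿ] = #Cl_{K⁺}[2ⁿ]` for every `n`** («the `2`-parts of `C_{F⁺}` and `C_F`
are isomorphic when `h⁻_F` is odd»): the norm `N : Cl_K → Cl_{K⁺}` (onto, kernel `A_K` of odd order `m`)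
restricts to a bijection of the `2ⁿ`-torsion — injective since `A_K ∩ Cl_K[2ⁿ] = 1`, onto since for
`N c = d` and `m t ≡ 1 (mod 2ⁿ)` the class `c^{mt}` is `2ⁿ`-torsion above `d`.
[cite: Okazaki2000, §5 Remark (p. 331)] -/
theorem IsCMField.card_twoPowTorsion_classGroup_eq_of_odd
    (hodd : Odd (classNumber K / classNumber (maximalRealSubfield K))) (n : ℕ) :
    Nat.card {c : ClassGroup (𝓞 K) // c ^ 2 ^ n = 1} =
      Nat.card {d : ClassGroup (𝓞 (maximalRealSubfield K)) // d ^ 2 ^ n = 1} := by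
  classical
  set N := classGroupNorm (maximalRealSubfield K) K with hN
  set AK := N.ker with hAK
  set m := Nat.card AK with hm
  rw [IsCMField.classNumber_div_eq_card_ker] at hodd
  have hcop : Nat.Coprime (2 ^ n) m := Nat.Coprime.pow_left n hodd.coprime_two_left
  -- every element of `A_K` is killed by `m`
  have hpowm : ∀ a ∈ AK, a ^ m = 1 := fun a ha => by
    have h : (⟨a, ha⟩ : AK) ^ Nat.card AK = 1 := pow_card_eq_one'
    rwa [← Subtype.coe_inj, Subgroup.coe_pow, Subgroup.coe_one] at h
  -- the restriction of `N` to the `2ⁿ`-torsion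
  let F : {c : ClassGroup (𝓞 K) // c ^ 2 ^ n = 1} →
      {d : ClassGroup (𝓞 (maximalRealSubfield K)) // d ^ 2 ^ n = 1} :=
    fun c => ⟨N c, by rw [← map_pow, c.2, map_one]⟩
  refine Nat.card_congr (Equiv.ofBijective F ⟨?_, ?_⟩)
  · -- injective
    intro c₁ c₂ h
    have h' : N c₁ = N c₂ := congrArg Subtype.val h
    apply Subtype.ext
    have hmem : (c₁ : ClassGroup (𝓞 K)) * (c₂ : ClassGroup (𝓞 K))⁻¹ ∈ AK := by
      rw [hAK, MonoidHom.mem_ker, map_mul, map_inv, h', mul_inv_cancel]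
    have hpow : ((c₁ : ClassGroup (𝓞 K)) * (c₂ : ClassGroup (𝓞 K))⁻¹) ^ 2 ^ n = 1 := by
      rw [mul_pow, inv_pow, c₁.2, c₂.2, inv_one, mul_one]
    have h1 : orderOf ((c₁ : ClassGroup (𝓞 K)) * (c₂ : ClassGroup (𝓞 K))⁻¹) ∣ 1 := by
      rw [← hcop.gcd_eq_one]  -- gcd (2^n) m = 1
      exact Nat.dvd_gcd (orderOf_dvd_of_pow_eq_one hpow) (orderOf_dvd_of_pow_eq_one (hpowm _ hmem))
    rw [Nat.dvd_one, orderOf_eq_one_iff] at h1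
    exact mul_inv_eq_one.mp h1
  · -- surjective
    rintro ⟨d, hd⟩
    obtain ⟨c, hc⟩ := IsCMField.classGroupNorm_maximalRealSubfield_surjective K d
    rcases Nat.eq_zero_or_pos n with hn | hn
    · subst hn
      rw [pow_zero, pow_one] at hd
      refine ⟨⟨1, by rw [pow_zero, pow_one]⟩, Subtype.ext ?_⟩
      change N 1 = d
      rw [map_one, hd]
    · have h1 : 1 < 2 ^ n := Nat.one_lt_two_pow (Nat.pos_iff_ne_zero.mp hn)
      obtain ⟨t, -, ht⟩ := Nat.exists_mul_mod_eq_one_of_coprime hcop.symm h1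
      have hmt : m * t = 2 ^ n * (m * t / 2 ^ n) + 1 := by
        have := Nat.div_add_mod (m * t) (2 ^ n)
        rw [ht] at this
        exact this.symm
      have hcA : c ^ 2 ^ n ∈ AK := by
        rw [hAK, MonoidHom.mem_ker, map_pow, hc, hd]
      refine ⟨⟨c ^ (m * t), ?_⟩, Subtype.ext ?_⟩
      · rw [← pow_mul, mul_comm, pow_mul, pow_mul, hpowm _ hcA, one_pow]
      · change N (c ^ (m * t)) = d
        rw [map_pow, hc, hmt, pow_succ, pow_mul, hd, one_pow, one_mul]

/-- **If `h⁻_K` is odd then the `2`-rank of `Cl_K` is at most `1`: `#Cl_K[2] ∣ 2`** (Okazaki: «It is known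
that the `2`-rank of `C_F` is at most `1` (cf. [13, Theorem 1])», [13] = Horie 1994).
[cite: Okazaki2000, §5 Remark (p. 331)] [cite: Horie1994, Thm. 1] -/
theorem IsCMField.card_twoTorsion_classGroup_dvd_two_of_odd
    (hodd : Odd (classNumber K / classNumber (maximalRealSubfield K))) :
    Nat.card {c : ClassGroup (𝓞 K) // c ^ 2 = 1} ∣ 2 := by
  have h := IsCMField.card_twoPowTorsion_classGroup_eq_of_odd K hodd 1
  rw [pow_one] at h
  rw [h]
  exact IsCMField.card_twoTorsion_classGroup_maximalRealSubfield_dvd_two_of_odd K hodd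

end Odd

/-! ### §3. `h_{K⁺}` odd: `ι` is injective and the ambiguous classes are `ι(Cl_{K⁺}) × Cl_K[2]` (Okazaki, proof of Lemma 17) -/

section Ambiguous

variable (K : Type) [Field K] [NumberField K] [IsCMField K]

/-- **`h_{K⁺}` odd ⟹ `ι : Cl_{K⁺} → Cl_K` is injective** (`κ_K ∣ 2` and `κ_K ∣ h_{K⁺}`; Okazaki: «`ιC_{F⁺}` is
isomorphic to `C_{F⁺}` since `h_{F⁺}` is odd and `κ_F` divides `2` by Lemma 14»).
[cite: Okazaki2000, §3 Lemma 17 (proof)] [cite: Washington1997, Thm. 10.3] -/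
theorem IsCMField.classGroupExtend_injective_of_odd_classNumber
    (hodd : Odd (classNumber (maximalRealSubfield K))) :
    Function.Injective (classGroupExtend (maximalRealSubfield K) K) := by
  have h2 := card_ker_classGroupExtend_dvd_two K
  have hh : Nat.card (classGroupExtend (maximalRealSubfield K) K).ker ∣ classNumber (maximalRealSubfield K) := by
    rw [classNumber, ← Nat.card_eq_fintype_card]
    exact Subgroup.card_subgroup_dvd_card _
  have h1 : Nat.card (classGroupExtend (maximalRealSubfield K) K).ker = 1 :=
    Nat.Coprime.eq_one_of_dvd (Nat.Coprime.coprime_dvd_left h2 hodd.coprime_two_left) hh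
  rw [← MonoidHom.ker_eq_bot_iff]
  exact Subgroup.eq_bot_of_card_eq _ h1

/-- `\overline{ι(e)} = ι(e)` (`ι(e)·\overline{ι(e)} = ι(N ι e) = ι(e²)`; = `IsCMField.conj_smul_classGroupExtend` of
`CMFieldNormCokernelExponentTwo.lean`, re-proved to keep this file's imports light). [cite: Okazaki2000, §5, proof of Prop. 27] -/
private theorem conj_smul_classGroupExtend_aux (e : ClassGroup (𝓞 (maximalRealSubfield K))) :
    ClassGroup.mulEquiv (AmbiguousClass.intAut (complexConj K)) (classGroupExtend (maximalRealSubfield K) K e) =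
      classGroupExtend (maximalRealSubfield K) K e := by
  have h := IsCMField.classGroupExtend_classGroupNorm K (classGroupExtend (maximalRealSubfield K) K e)
  rw [classGroupNorm_classGroupExtend (maximalRealSubfield K) K, (IsCMField.isQuadraticExtension K).finrank_eq_two,
    map_pow, pow_two] at h
  exact (mul_left_cancel h).symm

/-- If `h_{K⁺}` is odd, every `2`-torsion class of `K` is ambiguous: `c² = 1 ⟹ c̄ = c` (`c̄ = c⁻¹ ι(N c)` and
`N c ∈ Cl_{K⁺}[2] = 1`). [cite: Okazaki2000, §3 Lemma 17 (proof)] -/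
theorem IsCMField.conj_smul_eq_self_of_sq_eq_one_of_odd (hodd : Odd (classNumber (maximalRealSubfield K)))
    {c : ClassGroup (𝓞 K)} (hc : c ^ 2 = 1) :
    ClassGroup.mulEquiv (AmbiguousClass.intAut (complexConj K)) c = c := by
  have hN : classGroupNorm (maximalRealSubfield K) K c = 1 := by
    have hsq : classGroupNorm (maximalRealSubfield K) K c ^ 2 = 1 := by rw [← map_pow, hc, map_one]
    have hord : orderOf (classGroupNorm (maximalRealSubfield K) K c) ∣ 1 := by
      have h1 : orderOf (classGroupNorm (maximalRealSubfield K) K c) ∣ 2 := orderOf_dvd_of_pow_eq_one hsq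
      have h2 : orderOf (classGroupNorm (maximalRealSubfield K) K c) ∣ classNumber (maximalRealSubfield K) := by
        rw [classNumber, ← Nat.card_eq_fintype_card]; exact orderOf_dvd_natCard _
      have := Nat.Coprime.coprime_dvd_left h1 hodd.coprime_two_left
      exact this.eq_one_of_dvd h2 ▸ dvd_refl _
    rw [Nat.dvd_one, orderOf_eq_one_iff] at hord
    exact hord
  rw [IsCMField.conj_smul_eq_inv_of_classGroupNorm_eq_one K hN]
  -- `c⁻¹ = c` as `c² = 1`
  rw [inv_eq_iff_mul_eq_one, ← pow_two, hc]

/-- **The structural half of Okazaki's proof of Lemma 17: for `h_{K⁺}` odd, `#{c ∈ Cl_K : c̄ = c} = h_{K⁺} · #Cl_K[2]`**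
— the ambiguous classes are the internal direct product of `ι(Cl_{K⁺}) ≅ Cl_{K⁺}` (odd order) and `Cl_K[2]`:
both are ambiguous; conversely `c̄ = c` gives `c² = ι(N c) = ι(e²)` (squaring is onto on `Cl_{K⁺}`), so
`c = ι(e) · (c ι(e)⁻¹)` with `(c ι(e)⁻¹)² = 1`; and `ι(Cl_{K⁺}) ∩ Cl_K[2] = 1`.  (Okazaki: «the group `A_F` [of
ambiguous ideal classes] is isomorphic to the direct product of `ιC_{F⁺}` and `ker(2 : C_F → C_F)`»; with
Takagi–Chevalley's `#A_F = 2^{t-1} h_{F⁺}` — not typed here — this is Lemma 17, `rank₂ C_F = t − 1`.)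
[cite: Okazaki2000, §3 Lemma 17 (proof)] -/
theorem IsCMField.card_ambiguous_eq_classNumber_mul_card_twoTorsion_of_odd
    (hodd : Odd (classNumber (maximalRealSubfield K))) :
    Nat.card {c : ClassGroup (𝓞 K) // ClassGroup.mulEquiv (AmbiguousClass.intAut (complexConj K)) c = c} =
      classNumber (maximalRealSubfield K) * Nat.card {c : ClassGroup (𝓞 K) // c ^ 2 = 1} := by
  classical
  set ι := classGroupExtend (maximalRealSubfield K) K with hι
  set σ := ClassGroup.mulEquiv (AmbiguousClass.intAut (complexConj K)) with hσ
  have hinj : Function.Injective ι := IsCMField.classGroupExtend_injective_of_odd_classNumber K hodd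
  -- squaring is onto on `Cl_{K⁺}` (odd order)
  have hsq : ∀ d : ClassGroup (𝓞 (maximalRealSubfield K)), ∃ e, e ^ 2 = d := fun d => by
    obtain ⟨k, hk⟩ := hodd
    refine ⟨d ^ (k + 1), ?_⟩
    rw [← pow_mul, show (k + 1) * 2 = classNumber (maximalRealSubfield K) + 1 by omega, pow_succ,
      classNumber, ← Nat.card_eq_fintype_card, pow_card_eq_one', one_mul]
  -- the product map `Cl_{K⁺} × Cl_K[2] → {ambiguous}`
  let F : ClassGroup (𝓞 (maximalRealSubfield K)) × {c : ClassGroup (𝓞 K) // c ^ 2 = 1} →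
      {c : ClassGroup (𝓞 K) // σ c = c} :=
    fun p => ⟨ι p.1 * p.2, by
      rw [map_mul, hσ, hι, conj_smul_classGroupExtend_aux K,
        IsCMField.conj_smul_eq_self_of_sq_eq_one_of_odd K hodd p.2.2]⟩
  have hF : Function.Bijective F := by
    constructor
    · rintro ⟨e₁, t₁⟩ ⟨e₂, t₂⟩ h
      have h' : ι e₁ * (t₁ : ClassGroup (𝓞 K)) = ι e₂ * t₂ := congrArg Subtype.val h
      -- squaring kills `t₁, t₂`: `ι(e₁)² = ι(e₂)²`, so `(e₁/e₂)² = 1` by injectivity, so `e₁ = e₂` (odd order)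
      have hsqι : ι e₁ ^ 2 = ι e₂ ^ 2 := by
        have h2 := congrArg (fun x : ClassGroup (𝓞 K) => x ^ 2) h'
        simpa [mul_pow, t₁.2, t₂.2] using h2
      have hsq1 : (e₁ * e₂⁻¹) ^ 2 = 1 := hinj (by
        rw [map_pow, map_mul, map_inv, mul_pow, inv_pow, hsqι, mul_inv_cancel, map_one])
      have he : e₁ * e₂⁻¹ = 1 := by
        have h1 : orderOf (e₁ * e₂⁻¹) ∣ 2 := orderOf_dvd_of_pow_eq_one hsq1
        have h2 : orderOf (e₁ * e₂⁻¹) ∣ classNumber (maximalRealSubfield K) := by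
          rw [classNumber, ← Nat.card_eq_fintype_card]; exact orderOf_dvd_natCard _
        have h3 := (Nat.Coprime.coprime_dvd_left h1 hodd.coprime_two_left).eq_one_of_dvd h2
        rwa [orderOf_eq_one_iff] at h3
      have he' : e₁ = e₂ := mul_inv_eq_one.mp he
      subst he'
      have ht : (t₁ : ClassGroup (𝓞 K)) = t₂ := mul_left_cancel h'
      rw [Subtype.ext ht]
    · rintro ⟨c, hc⟩
      -- `c² = ι(N c) = ι(e²)`
      obtain ⟨e, he⟩ := hsq (classGroupNorm (maximalRealSubfield K) K c)
      have hc2 : c ^ 2 = ι (e ^ 2) := by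
        rw [he, hι, IsCMField.classGroupExtend_classGroupNorm K c, ← hσ, hc, pow_two]
      refine ⟨⟨e, ⟨c * (ι e)⁻¹, ?_⟩⟩, Subtype.ext ?_⟩
      · rw [mul_pow, inv_pow, hc2, map_pow, mul_inv_cancel]
      · change ι e * (c * (ι e)⁻¹) = c
        rw [mul_comm, inv_mul_cancel_right]
  rw [← Nat.card_congr (Equiv.ofBijective F hF), Nat.card_prod, classNumber, Nat.card_eq_fintype_card]

end Ambiguous

/-! ### §4. `h⁻_K` odd: the norm is an isomorphism of the `2`-primary components `Cl_K{2} ≃* Cl_{K⁺}{2}` -/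

section Sylow

variable (K : Type) [Field K] [NumberField K] [IsCMField K]

/-- **«The `2`-parts of `C_{F⁺}` and `C_F` are isomorphic when `h⁻_F` is odd», as an isomorphism**: if `h⁻_K` is
odd, the norm `N : Cl_K → Cl_{K⁺}` restricts to a group isomorphism of the `2`-primary components
`Cl_K{2} = {c : ord c is a power of 2}` and `Cl_{K⁺}{2}` — injective because `ker N = A_K` has odd order `m`
(so meets `Cl_K{2}` trivially), onto because for `N c = d` with `d^{2ⁿ} = 1` and `m t ≡ 1 (mod 2ⁿ)` the class
`c^{m t}` lies in `Cl_K{2}` above `d`. [cite: Okazaki2000, §5 Remark (p. 331)] [cite: Horie1994, Thm. 1 (proof)] -/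
theorem IsCMField.exists_mulEquiv_primaryComponent_two_of_odd
    (hodd : Odd (classNumber K / classNumber (maximalRealSubfield K))) :
    ∃ e : CommGroup.primaryComponent (ClassGroup (𝓞 K)) 2 ≃*
        CommGroup.primaryComponent (ClassGroup (𝓞 (maximalRealSubfield K))) 2,
      ∀ c, (e c : ClassGroup (𝓞 (maximalRealSubfield K))) = classGroupNorm (maximalRealSubfield K) K c := by
  classical
  set N := classGroupNorm (maximalRealSubfield K) K with hN
  set AK := N.ker with hAK
  set m := Nat.card AK with hm
  rw [IsCMField.classNumber_div_eq_card_ker] at hodd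
  -- every element of `A_K` is killed by the odd number `m`
  have hpowm : ∀ a ∈ AK, a ^ m = 1 := fun a ha => by
    have h : (⟨a, ha⟩ : AK) ^ Nat.card AK = 1 := pow_card_eq_one'
    rwa [← Subtype.coe_inj, Subgroup.coe_pow, Subgroup.coe_one] at h
  -- `N` maps `Cl_K{2}` into `Cl_{K⁺}{2}`
  have hmap : ∀ c ∈ CommGroup.primaryComponent (ClassGroup (𝓞 K)) 2,
      N c ∈ CommGroup.primaryComponent (ClassGroup (𝓞 (maximalRealSubfield K))) 2 := fun c hc => by
    obtain ⟨k, hk⟩ := (CommGroup.mem_primaryComponent).mp hc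
    exact (CommGroup.mem_primaryComponent).mpr ⟨k, by rw [← map_pow, hk, map_one]⟩
  set f : CommGroup.primaryComponent (ClassGroup (𝓞 K)) 2 →*
      CommGroup.primaryComponent (ClassGroup (𝓞 (maximalRealSubfield K))) 2 :=
    (N.comp (CommGroup.primaryComponent (ClassGroup (𝓞 K)) 2).subtype).codRestrict _
      (fun c => hmap c.1 c.2) with hf
  have hfapply : ∀ c, (f c : ClassGroup (𝓞 (maximalRealSubfield K))) = N c := fun c => rfl
  refine ⟨MulEquiv.ofBijective f ⟨?_, ?_⟩, fun c => hfapply c⟩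
  · -- injective: `Cl_K{2} ∩ A_K = 1`
    rw [← MonoidHom.ker_eq_bot_iff, Subgroup.eq_bot_iff_forall]
    intro c hc
    have hc1 : N (c : ClassGroup (𝓞 K)) = 1 := by
      rw [← hfapply, MonoidHom.mem_ker.mp hc, OneMemClass.coe_one]
    obtain ⟨k, hk⟩ := (CommGroup.mem_primaryComponent).mp c.2
    have hcop : Nat.Coprime (2 ^ k) m := Nat.Coprime.pow_left k hodd.coprime_two_left
    have h1 : orderOf (c : ClassGroup (𝓞 K)) ∣ 1 := by
      rw [← hcop.gcd_eq_one]
      exact Nat.dvd_gcd (orderOf_dvd_of_pow_eq_one hk)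
        (orderOf_dvd_of_pow_eq_one (hpowm _ (MonoidHom.mem_ker.mpr hc1)))
    rw [Nat.dvd_one, orderOf_eq_one_iff] at h1
    exact Subtype.ext h1
  · -- surjective
    rintro ⟨d, hd⟩
    obtain ⟨n, hdn⟩ := (CommGroup.mem_primaryComponent).mp hd
    obtain ⟨c, hc⟩ := IsCMField.classGroupNorm_maximalRealSubfield_surjective K d
    have hcop : Nat.Coprime (2 ^ n) m := Nat.Coprime.pow_left n hodd.coprime_two_left
    have hcA : c ^ 2 ^ n ∈ AK := by
      rw [hAK, MonoidHom.mem_ker, map_pow, hc, hdn]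
    rcases Nat.eq_zero_or_pos n with hn | hn
    · subst hn
      rw [pow_zero, pow_one] at hdn
      refine ⟨⟨1, Subgroup.one_mem _⟩, Subtype.ext ?_⟩
      rw [hfapply]
      change N 1 = d
      rw [map_one, hdn]
    · have h1 : 1 < 2 ^ n := Nat.one_lt_two_pow (Nat.pos_iff_ne_zero.mp hn)
      obtain ⟨t, -, ht⟩ := Nat.exists_mul_mod_eq_one_of_coprime hcop.symm h1
      have hmt : m * t = 2 ^ n * (m * t / 2 ^ n) + 1 := by
        have := Nat.div_add_mod (m * t) (2 ^ n)
        rw [ht] at this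
        exact this.symm
      have hmem : c ^ (m * t) ∈ CommGroup.primaryComponent (ClassGroup (𝓞 K)) 2 :=
        (CommGroup.mem_primaryComponent).mpr ⟨n, by
          rw [← pow_mul, mul_comm, pow_mul, pow_mul, hpowm _ hcA, one_pow]⟩
      refine ⟨⟨c ^ (m * t), hmem⟩, Subtype.ext ?_⟩
      rw [hfapply]
      change N (c ^ (m * t)) = d
      rw [map_pow, hc, hmt, pow_succ, pow_mul, hdn, one_pow, one_mul]

/-- **`h⁻_K` odd ⟹ `#Cl_K{2} = #Cl_{K⁺}{2}`** (the Sylow `2`-subgroups of `Cl_K` and `Cl_{K⁺}` have the same order).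
[cite: Okazaki2000, §5 Remark (p. 331)] -/
theorem IsCMField.card_primaryComponent_two_classGroup_eq_of_odd
    (hodd : Odd (classNumber K / classNumber (maximalRealSubfield K))) :
    Nat.card (CommGroup.primaryComponent (ClassGroup (𝓞 K)) 2) =
      Nat.card (CommGroup.primaryComponent (ClassGroup (𝓞 (maximalRealSubfield K))) 2) := by
  obtain ⟨e, -⟩ := IsCMField.exists_mulEquiv_primaryComponent_two_of_odd K hodd
  exact Nat.card_congr e.toEquiv

end Sylow

end Literature.NumberTheory.NumberFields

end
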